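import Literature.Algebra.Lie.LefschetzModule
import Literature.Geometry.Kaehler.ComplexTorusTotalLieAlgebraRatJordanLefschetzPair
import Literature.Geometry.Kaehler.ComplexTorusJordanLefschetzModules
import Literature.Geometry.Kaehler.ComplexTorusTotalLieAlgebraSimple
import HarnessLib

/-!
# The cohomology of a complex torus as a Lefschetz module in the abstract sense of Looijenga–Lunts §1
# (rows A1-43/A1-45/A1-85 READ BACK through `Algebra/Lie/LefschetzModule.lean`)

Topic `Literature/Geometry/Kaehler`, namespace `Literature.Geometry.Kaehler.ComplexTorus`; lane `lit-hodgefound` (Track 2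
foundations library), Layer A1 «complex tori · H^k = ⋀^k H¹», skeleton seat `lit-hodgefound-skel-1` (generation 39), row
**A1-89** of `run/shared/lean/pub/lit-hodgefound/SKELETON.md` — the BRIDGE announced in SCOPE (d) of row A1-88
(`Algebra/Lie/LefschetzModule.lean`): for the complex torus `X = E/Λ` (`V = H₁(X; ℝ) = E`, `H•(X; ℂ) = GForm E ℂ = Πₖ ⋀ᵏ V^*
⊗ ℂ`, counting operator `h = countingG E` acting by `k - g` on `⋀ᵏ`, Lefschetz operators `e_η = lefschetzG η`, dual
operators `Λ_η = lefschetzDualG η`, total Lie algebra `𝔤_tot(X; ℝ) = totalLieAlgebra E`, `ℚ`-form `𝔤_tot(X; ℚ) =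
totalLieAlgebraRat Φ`), the abstract notions of row A1-88 evaluate as follows.  THEOREMS ONLY (no definition, no named
fact, no `sorry`); the commutator Lie ring of `𝔤𝔩_ℂ(H•(X; ℂ))` is Mathlib's reducible non-instance
`LieRing.ofAssociativeRing`, enabled file-locally as in every parent file.

## Source, verbatim (E. Looijenga, V. A. Lunts, *A Lie algebra attached to a projective variety*, Invent. Math. 129
(1997) 361–412 = arXiv:alg-geom/9604014; held text `paper:arxiv-alg-geom_9604014`)

* §1 (1.1) p0003 L106–p0004 L5: "Let `M` be a `ℤ`-graded `K`-vector space of finite dimension and denote by `h : M → M` the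
  transformation that is multiplication by `k` in degree `k`. […] `e : M → M` of degree `2` has the Lefschetz property if
  for all integers `k ≥ 0`, `e^k` maps `M_{-k}` isomorphically onto `M_k`. According to the Jacobson–Morozov lemma this is
  equivalent to the existence of `K`-linear transformation `f` in `M` of degree `-2` such that `[e, f] = h`. This `f` is
  then unique".
* p0004 L28–L37, L56–L58: "We regard `𝔞` as a graded abelian Lie algebra which is homogeneous of degree two. We say that a
  graded Lie homomorphism `e : 𝔞 → 𝔤𝔩(M)` has the Lefschetz property if for some `a ∈ 𝔞`, `e_a` has that property. […]
  We let `𝔤(𝔞, M)` denote the Lie subalgebra of `𝔤𝔩(M)` generated by the transformations `e_a, f_a`. […] We say that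
  `(𝔞, M)` is a Lefschetz module if `𝔤(𝔞, M)` is semisimple."
* §1 (1.9) p0006: "we could even take all cohomology classes of degree `2` that have the Lefschetz property […] The
  resulting Lie algebra's are again semisimple and we call them […] the total Lie algebra"; §3 (3.3) p0013: "Furthermore,
  `H^{ev}(X)[n]` is a semispinorial representation of `𝔤_tot(X; ℝ)` and a fundamental Jordan–Lefschetz module of
  `H²(X, ℝ)`"; §1 p0007 L58–L64: "(i) the adjoint representation of `𝔤` makes `𝔤` a Lefschetz module over `𝔞`".

## What is formalised (all `theorem`s, proved)

* §1 **`h` is the degree operator of a `ℤ`-grading of `H•(X; ℂ)`**: `mem_degreeSpace_countingG_iff` (`M_{k-g} = ⋀ᵏ`, i.e.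
  row A1-43's `mem_eigenspace_countingG_iff_isHomog` in the vocabulary `degreeSpace` of A1-88), `of_mem_degreeSpace_countingG`,
  **`isZGrading_countingG`** (`IsZGrading (countingG E)`), `degreeSpace_countingG_eq_bot_of_lt` (`M_n = 0` for `n < -g`).
* §2 **the Lefschetz property of `e_η` IS non-degeneracy of `η`**: `hasLefschetzProperty_lefschetzG_iff`
  (`HasLefschetzProperty h e_η ↔ η` non-degenerate — A1-88's (1.1) `hasLefschetzProperty_iff_exists_isSl2Triple` composed
  with A1-43's `isSl2Triple_iff`), and **the tree's explicit `Λ_η` IS the abstract partner**: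
  `dual_lefschetzG_eq_lefschetzDualG` (`(HasLefschetzProperty …).dual = lefschetzDualG η`, by uniqueness).
* §3 **`𝔞 = e(H²(X; ℝ))` and `𝔤(𝔞, H•(X; ℂ)) = 𝔤_tot(X; ℝ)`**, with `𝔞` the `ℝ`-span of the Lefschetz operators
  `Submodule.span ℝ (range lefschetzG)`: `span_range_lefschetzG_le_totalLieAlgebra`, `span_range_lefschetzG_le_adDegree_two`
  ("homogeneous of degree two"), `lie_eq_zero_of_mem_span_range_lefschetzG` ("abelian"), `exists_eq_lefschetzG_of_mem_span`
  (every element of `𝔞` is an `e_κ`, row A1-45), `mem_lefschetzDomain_span_iff` / `mem_lefschetzDuals_span_iff` (the domain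
  of `f` on `𝔞` = the `e_η` with `η` non-degenerate, its image = the `Λ_η`), `nonempty_lefschetzDomain_span`,
  **`lefschetzLieAlgebra_span_range_lefschetzG`** (`𝔤(𝔞, H•(X; ℂ)) = totalLieAlgebra E`) and
  `isSemisimple_lefschetzLieAlgebra_span` (it is semisimple, row A1-57's `isSemisimple_totalLieAlgebra'`) — i.e. ALL the
  clauses of "Lefschetz module" for `(H²(X; ℝ), H•(X; ℂ))`, over the pair of fields `(ℝ, ℂ)` (see SCOPE (a)).
* §4 **(i) in the adjoint representation of `𝔤_tot(X; ℚ)` and `𝔤_NS(X; ℚ)`**: `hasLefschetzProperty_ad_totalLieAlgebraRat`,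
  `hasLefschetzProperty_ad_lefschetzG_totalLieAlgebraRat` (every rational non-degenerate `η`: `ad e_η` has the Lefschetz
  property on `(𝔤_tot(X; ℚ), ad h)`), `IsRiemannForm.hasLefschetzProperty_ad_neronSeveriLieAlgebraRat` — A1-88 §7 applied to
  the Jordan–Lefschetz pairs of rows A1-85/A1-86.
* §5 **the depth is `g`**: `degreeSpace_countingG_eq_bot_of_gt` (`M_n = 0` for `n > g`), `degreeSpace_countingG_neg_ne_bot`
  (`M_{-g} = ⋀⁰ ≠ 0`), `degreeSpace_countingG_ne_bot` (`M_g ≠ 0`, through the Lefschetz isomorphism of a split frame form),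
  **`depth_countingG`** (`depth (countingG E) = finrank ℂ E`, row A1-88's `depth`).

SCOPE. (a) A1-88's one-field predicate `IsLefschetzModule K h 𝔞` (`𝔞 ≤ 𝔤𝔩_K(M)`, `𝔤(𝔞, M)` a `K`-Lie algebra) is not
instantiated verbatim: the lane's carrier is `H•(X; ℂ)` (a `ℂ`-space) while `𝔞 = e(H²(X; ℝ))` and `𝔤_tot(X; ℝ)` are REAL
(a real form acting on the complexification); §3 proves each clause in that mixed setting, and the verbatim instance awaits
either real coefficients `H•(X; ℝ)` on the module side or a two-field variant of the predicate — TODO(general form).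
(b) The explicit isomorphisms `e_η^k : ⋀^{g-k} ≅ ⋀^{g+k}` are not restated (row A1-08/A1-43's hard Lefschetz files carry
them). (c) Nothing here concerns the Hodge conjecture.

## References

* [LooijengaLunts1997] E. Looijenga, V. A. Lunts, *A Lie algebra attached to a projective variety*, Invent. Math. 129
  (1997) 361–412; §1 (1.1), (1.9), p. 7 (i); §3 (3.3).
* [Huybrechts2005] D. Huybrechts, *Complex Geometry*, Springer (2005), §1.2 (Def. 1.2.25, Prop. 1.2.26, Cor. 1.2.27, Prop. 1.2.30).
-/

noncomputable section

-- The commutator Lie ring of `Module.End ℂ (GForm E ℂ)`: Mathlib's reducible NON-instance `LieRing.ofAssociativeRing`,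
-- enabled file-locally exactly as in `ComplexTorusLefschetzSl2Triple.lean` / `ComplexTorusTotalLieAlgebra.lean`.
attribute [local instance 100] LieRing.ofAssociativeRing

namespace Literature.Geometry.Kaehler

namespace ComplexTorus

open Module Function Set Literature.LinearAlgebra.Alternating Literature.Algebra.Lie

/-! ### §1 `h = countingG E` is the degree operator of a `ℤ`-grading of `H•(X; ℂ)` -/

section Grading

variable {E : Type*} [NormedAddCommGroup E] [NormedSpace ℂ E] [FiniteDimensional ℂ E]

omit [FiniteDimensional ℂ E] in
/-- **`M_{k-g} = ⋀ᵏ V^* ⊗ ℂ`**: the degree-`(k - g)` part of `(H•(X; ℂ), h)` in the sense of row A1-88 consists of the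
homogeneous graded forms of degree `k` ("multiplication by `k` in degree `k`", with Huybrechts' shift by `g`).
[cite: LooijengaLunts1997, §1 (1.1) p. 3 L106–L108] [cite: Huybrechts2005, Def. 1.2.25] -/
theorem mem_degreeSpace_countingG_iff {k : ℕ} {w : GForm E ℂ} :
    w ∈ degreeSpace (countingG E) ((k : ℤ) - (finrank ℂ E : ℤ)) ↔ GForm.IsHomog k w := by
  rw [degreeSpace, Int.cast_sub, Int.cast_natCast, Int.cast_natCast]
  exact mem_eigenspace_countingG_iff_isHomog

omit [FiniteDimensional ℂ E] in
/-- A homogeneous form of degree `k` lies in `M_{k-g}`. [cite: Huybrechts2005, Def. 1.2.25] -/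
theorem of_mem_degreeSpace_countingG (k : ℕ) (α : E [⋀^Fin k]→L[ℝ] ℂ) :
    GForm.of k α ∈ degreeSpace (countingG E) ((k : ℤ) - (finrank ℂ E : ℤ)) := by
  rw [degreeSpace, Int.cast_sub, Int.cast_natCast, Int.cast_natCast]
  exact of_mem_eigenspace_countingG k α

/-- **`(H•(X; ℂ), h)` is `ℤ`-graded**: `IsZGrading (countingG E)` — every graded form is the sum of its homogeneous
components (row A1-43's `sum_range_of_eq`). [cite: LooijengaLunts1997, §1 (1.1) p. 3 L106–L108] [cite: Huybrechts2005, Def. 1.2.25] -/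
theorem isZGrading_countingG : IsZGrading (countingG E) := by
  rw [IsZGrading, eq_top_iff]
  rintro w -
  rw [← sum_range_of_eq w]
  exact Submodule.sum_mem _ fun m _ ↦
    Submodule.mem_iSup_of_mem ((m : ℤ) - (finrank ℂ E : ℤ)) (of_mem_degreeSpace_countingG m (w m))

omit [FiniteDimensional ℂ E] in
/-- No degrees below `-g`: `M_n = 0` for `n < -g`. [cite: Huybrechts2005, Def. 1.2.25] -/
theorem degreeSpace_countingG_eq_bot_of_lt {n : ℤ} (hn : n < -(finrank ℂ E : ℤ)) : degreeSpace (countingG E) n = ⊥ := by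
  rw [Submodule.eq_bot_iff]
  intro w hw
  rw [degreeSpace, mem_eigenspace_countingG_iff] at hw
  funext m
  refine hw m fun h ↦ ?_
  have h' : (((m : ℤ) - (finrank ℂ E : ℤ) : ℤ) : ℂ) = ((n : ℤ) : ℂ) := by push_cast; exact h
  have := Int.cast_inj.1 h'
  omega

end Grading

/-! ### §2 The Lefschetz property of `e_η` is non-degeneracy of `η`; `Λ_η` is the abstract partner -/

section Lefschetz

variable {E : Type*} [NormedAddCommGroup E] [NormedSpace ℂ E] [FiniteDimensional ℂ E] [Nontrivial E]
  {η : E [⋀^Fin 2]→L[ℝ] ℝ}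

/-- **`e_η` has the Lefschetz property on `(H•(X; ℂ), h)` iff `η` is non-degenerate** (row A1-88's (1.1)
`hasLefschetzProperty_iff_exists_isSl2Triple` + row A1-43's `isSl2Triple_iff`). [cite: LooijengaLunts1997, §1 (1.1) p. 4 L1–L5, §3 proof of (3.3) ("Let κ ∈ ⋀²V^* be nondegenerate … f_κ is defined")] -/
theorem hasLefschetzProperty_lefschetzG_iff :
    HasLefschetzProperty (countingG E) (lefschetzG η) ↔ ∀ v : E, v ≠ 0 → ∃ w : E, η ![v, w] ≠ 0 := by
  rw [hasLefschetzProperty_iff_exists_isSl2Triple isZGrading_countingG countingG_ne_zero]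
  exact ⟨fun ⟨_, t⟩ ↦ nondegenerate_of_isSl2Triple t, fun hη ↦ ⟨lefschetzDualG η, isSl2Triple hη⟩⟩

/-- A non-degenerate `η` gives a Lefschetz operator `e_η`. [cite: LooijengaLunts1997, §1 (1.1), §3 proof of (3.3)] -/
theorem hasLefschetzProperty_lefschetzG (hη : ∀ v : E, v ≠ 0 → ∃ w : E, η ![v, w] ≠ 0) :
    HasLefschetzProperty (countingG E) (lefschetzG η) :=
  hasLefschetzProperty_lefschetzG_iff.2 hη

/-- **The tree's explicit `Λ_η` IS the abstract `𝔰𝔩₂`-partner `f` of row A1-88** ("This `f` is then unique").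
[cite: LooijengaLunts1997, §1 (1.1) p. 4 L4, §3 proof of (3.3) ("f_κ is defined and equal to ∑ i_{a_{-k}} i_{a_k}")] -/
theorem dual_lefschetzG_eq_lefschetzDualG (hη : ∀ v : E, v ≠ 0 → ∃ w : E, η ![v, w] ≠ 0) :
    (hasLefschetzProperty_lefschetzG hη).dual isZGrading_countingG = lefschetzDualG η :=
  ((hasLefschetzProperty_lefschetzG hη).eq_dual_of_isSl2Triple isZGrading_countingG (isSl2Triple hη)).symm

end Lefschetz

/-! ### §3 `𝔞 = e(H²(X; ℝ))` and `𝔤(𝔞, H•(X; ℂ)) = 𝔤_tot(X; ℝ)` -/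

section Total

variable {E : Type*} [NormedAddCommGroup E] [NormedSpace ℂ E] [FiniteDimensional ℂ E] [Nontrivial E]

/-- `𝔞 = span_ℝ {e_κ} ⊆ 𝔤_tot(X; ℝ)` (row A1-45's `lefschetzG_mem_totalLieAlgebra'`: EVERY `e_κ` lies in `𝔤_tot`).
[cite: LooijengaLunts1997, §1 (1.1) p. 4 L35–L37] -/
theorem span_range_lefschetzG_le_totalLieAlgebra :
    Submodule.span ℝ (Set.range (lefschetzG (E := E))) ≤ (totalLieAlgebra E).toSubmodule :=
  Submodule.span_le.2 (by rintro _ ⟨κ, rfl⟩; exact lefschetzG_mem_totalLieAlgebra' κ)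

omit [FiniteDimensional ℂ E] [Nontrivial E] in
/-- **"homogeneous of degree two"**: `𝔞 ⊆ 𝔤𝔩(H•)₂` (`[h, e_κ] = 2 e_κ`, row A1-43's `lie_countingG_lefschetzG`).
[cite: LooijengaLunts1997, §1 (1.1) p. 4 L28–L29] -/
theorem span_range_lefschetzG_le_adDegree_two :
    Submodule.span ℝ (Set.range (lefschetzG (E := E))) ≤ adDegree ℝ (countingG E) 2 := by
  refine Submodule.span_le.2 ?_
  rintro _ ⟨κ, rfl⟩
  rw [SetLike.mem_coe, mem_adDegree_iff, lie_countingG_lefschetzG]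
  exact (ofNat_smul_eq_nsmul ℝ 2 (lefschetzG κ)).symm

omit [Nontrivial E] in
/-- **"abelian"**: `[𝔞, 𝔞] = 0` (the `e_κ` commute: `lie_lefschetzG_lefschetzG`). [cite: LooijengaLunts1997, §1 (1.1) p. 4 L28–L29] -/
theorem lie_eq_zero_of_mem_span_range_lefschetzG {a b : Module.End ℂ (GForm E ℂ)}
    (ha : a ∈ Submodule.span ℝ (Set.range (lefschetzG (E := E))))
    (hb : b ∈ Submodule.span ℝ (Set.range (lefschetzG (E := E)))) : ⁅a, b⁆ = 0 := by
  refine Submodule.span_induction (p := fun a _ ↦ ⁅a, b⁆ = 0) ?_ (zero_lie b) (fun x y _ _ hx hy ↦ by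
    rw [add_lie, hx, hy, add_zero]) (fun c x _ hx ↦ by rw [smul_lie, hx, smul_zero]) ha
  rintro _ ⟨κ, rfl⟩
  refine Submodule.span_induction (p := fun b _ ↦ ⁅lefschetzG κ, b⁆ = 0) ?_ (lie_zero _) (fun x y _ _ hx hy ↦ by
    rw [lie_add, hx, hy, add_zero]) (fun c x _ hx ↦ by rw [lie_smul, hx, smul_zero]) hb
  rintro _ ⟨κ', rfl⟩
  exact lie_lefschetzG_lefschetzG κ κ'

/-- **Every element of `𝔞` is a Lefschetz operator `e_κ`** (row A1-45's `𝔤_tot(X; ℝ)₂ = {e_κ}`,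
`exists_eq_lefschetzG_of_lie_countingG`). [cite: LooijengaLunts1997, §2 (2.8), §3 (3.3)] -/
theorem exists_eq_lefschetzG_of_mem_span {a : Module.End ℂ (GForm E ℂ)}
    (ha : a ∈ Submodule.span ℝ (Set.range (lefschetzG (E := E)))) : ∃ κ : E [⋀^Fin 2]→L[ℝ] ℝ, a = lefschetzG κ :=
  exists_eq_lefschetzG_of_lie_countingG (span_range_lefschetzG_le_totalLieAlgebra ha)
    (by rw [← ofNat_smul_eq_nsmul ℝ]; exact mem_adDegree_iff.1 (span_range_lefschetzG_le_adDegree_two ha))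

/-- **The domain of `f` on `𝔞` consists of the `e_η` with `η` non-degenerate** ("the set of `a ∈ 𝔞` with the Lefschetz
property"; §3: "Let `κ ∈ ⋀² V^*` be nondegenerate […] it follows that `f_κ` is defined"). [cite: LooijengaLunts1997, §1 (1.1) p. 4 L30–L35, §3 proof of (3.3)] -/
theorem mem_lefschetzDomain_span_iff {a : Module.End ℂ (GForm E ℂ)} :
    a ∈ lefschetzDomain ℝ (countingG E) (Submodule.span ℝ (Set.range (lefschetzG (E := E)))) ↔
      ∃ η : E [⋀^Fin 2]→L[ℝ] ℝ, (∀ v : E, v ≠ 0 → ∃ w : E, η ![v, w] ≠ 0) ∧ a = lefschetzG η := by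
  constructor
  · rintro ⟨ha, f, t⟩
    obtain ⟨κ, rfl⟩ := exists_eq_lefschetzG_of_mem_span ha
    exact ⟨κ, nondegenerate_of_isSl2Triple t, rfl⟩
  · rintro ⟨η, hη, rfl⟩
    exact ⟨Submodule.subset_span ⟨η, rfl⟩, lefschetzDualG η, isSl2Triple hη⟩

/-- **The image of `f` consists of the `Λ_η`, `η` non-degenerate.** [cite: LooijengaLunts1997, §1 (1.1) p. 4 L33–L35, §3 proof of (3.3)] -/
theorem mem_lefschetzDuals_span_iff {f : Module.End ℂ (GForm E ℂ)} :
    f ∈ lefschetzDuals ℝ (countingG E) (Submodule.span ℝ (Set.range (lefschetzG (E := E)))) ↔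
      ∃ η : E [⋀^Fin 2]→L[ℝ] ℝ, (∀ v : E, v ≠ 0 → ∃ w : E, η ![v, w] ≠ 0) ∧ f = lefschetzDualG η := by
  constructor
  · rintro ⟨e, he, t⟩
    obtain ⟨κ, rfl⟩ := exists_eq_lefschetzG_of_mem_span he
    exact ⟨κ, nondegenerate_of_isSl2Triple t, eq_lefschetzDualG_of_isSl2Triple t⟩
  · rintro ⟨η, hη, rfl⟩
    exact ⟨lefschetzG η, Submodule.subset_span ⟨η, rfl⟩, isSl2Triple hη⟩

/-- A complex vector space of dimension `g ≥ 1` has a real frame of the split shape `(e₀, …, eₙ, f₀, …, fₙ)`, `n + 1 = g`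
(as in `ComplexTorusTotalLieAlgebra.lean`). [folklore] -/
private theorem exists_splitBasis_aux : ∃ n : ℕ, Nonempty (Module.Basis (Fin (n + 1) ⊕ Fin (n + 1)) ℝ E) := by
  obtain ⟨n, hn⟩ := Nat.exists_eq_succ_of_ne_zero (Module.finrank_pos (R := ℂ) (M := E)).ne'
  refine ⟨n, ⟨(Module.finBasis ℝ E).reindex ((finCongr ?_).trans finSumFinEquiv.symm)⟩⟩
  rw [finrank_real_of_complex, hn]
  omega

/-- **"`e : 𝔞 → 𝔤𝔩(M)` has the Lefschetz property": the domain of `f` on `𝔞 = e(H²(X; ℝ))` is non-empty** (the standard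
form of a split frame is non-degenerate). [cite: LooijengaLunts1997, §1 (1.1) p. 4 L30–L31, §3 ("The nondegenerate 2-forms make up a nonempty open subset")] -/
theorem nonempty_lefschetzDomain_span :
    (lefschetzDomain ℝ (countingG E) (Submodule.span ℝ (Set.range (lefschetzG (E := E))))).Nonempty := by
  obtain ⟨n, ⟨b⟩⟩ := exists_splitBasis_aux (E := E)
  exact ⟨lefschetzG (frameForm b), mem_lefschetzDomain_span_iff.2 ⟨frameForm b, frameForm_nondegenerate b, rfl⟩⟩

/-- **`𝔤(𝔞, H•(X; ℂ)) = 𝔤_tot(X; ℝ)`**: row A1-88's `lefschetzLieAlgebra` of `𝔞 = e(H²(X; ℝ))` in `𝔤𝔩_ℂ(H•(X; ℂ))` (as a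
real Lie algebra) IS the lane's `totalLieAlgebra E` ("We let `𝔤(𝔞, M)` denote the Lie subalgebra of `𝔤𝔩(M)` generated by
the transformations `e_a, f_a`" / (1.9) "the total Lie algebra"). [cite: LooijengaLunts1997, §1 (1.1) p. 4 L35–L37, (1.9)] -/
theorem lefschetzLieAlgebra_span_range_lefschetzG :
    lefschetzLieAlgebra ℝ (countingG E) (Submodule.span ℝ (Set.range (lefschetzG (E := E)))) = totalLieAlgebra E := by
  refine le_antisymm (lefschetzLieAlgebra_le_iff.2 ⟨span_range_lefschetzG_le_totalLieAlgebra, ?_⟩) ?_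
  · intro f hf
    obtain ⟨η, hη, rfl⟩ := mem_lefschetzDuals_span_iff.1 hf
    exact mem_totalLieAlgebra_of_isSl2Triple (isSl2Triple hη)
  · rw [totalLieAlgebra, LieSubalgebra.lieSpan_le]
    rintro T ⟨η, Λ, t, (rfl | rfl)⟩
    · exact mem_lefschetzLieAlgebra_of_mem (Submodule.subset_span ⟨η, rfl⟩)
    · exact mem_lefschetzLieAlgebra_of_isSl2Triple (Submodule.subset_span ⟨η, rfl⟩) t

/-- **"`(𝔞, M)` is a Lefschetz module if `𝔤(𝔞, M)` is semisimple"** — and it is: `𝔤(𝔞, H•(X; ℂ)) = 𝔤_tot(X; ℝ)` is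
semisimple for every `g ≥ 1` (the lane's `isSemisimple_totalLieAlgebra'`). [cite: LooijengaLunts1997, §1 (1.1) p. 4 L56–L58, (1.9) ("The resulting Lie algebra's are again semisimple")] -/
theorem isSemisimple_lefschetzLieAlgebra_span :
    LieAlgebra.IsSemisimple ℝ (lefschetzLieAlgebra ℝ (countingG E) (Submodule.span ℝ (Set.range (lefschetzG (E := E))))) := by
  rw [lefschetzLieAlgebra_span_range_lefschetzG]
  exact isSemisimple_totalLieAlgebra' E

/-- `h ∈ 𝔤(𝔞, H•(X; ℂ))`. [cite: LooijengaLunts1997, §1 (1.1) p. 4 L56–L57] -/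
theorem countingG_mem_lefschetzLieAlgebra_span :
    countingG E ∈ lefschetzLieAlgebra ℝ (countingG E) (Submodule.span ℝ (Set.range (lefschetzG (E := E)))) := by
  rw [lefschetzLieAlgebra_span_range_lefschetzG]
  exact countingG_mem_totalLieAlgebra' E

end Total

/-! ### §4 Condition (i) in the adjoint representations of `𝔤_tot(X; ℚ)` and `𝔤_NS(X; ℚ)` -/

section Adjoint

variable {ι : Type*} [Fintype ι] [DecidableEq ι] {E : Type*} [NormedAddCommGroup E] [NormedSpace ℂ E]
  [FiniteDimensional ℂ E] [Nontrivial E] (Φ : (ι → ℝ) ≃L[ℝ] E)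

/-- **(i) for `(𝔤_tot(X; ℚ), h)`**: every `e` in the domain of `f` on `𝔤₂(ℚ)` acts on `(𝔤_tot(X; ℚ), ad h)` with the
Lefschetz property, `(ad e)^k : 𝔤_{-k} ≅ 𝔤_k` (row A1-88 §7 on the Jordan–Lefschetz pair of rows A1-85/A1-86, every `g ≥ 1`).
[cite: LooijengaLunts1997, §1 p. 7 L58–L64 ("the adjoint representation of 𝔤 makes 𝔤 a Lefschetz module over 𝔞")] -/
theorem hasLefschetzProperty_ad_totalLieAlgebraRat {e : totalLieAlgebraRat Φ}
    (he : e ∈ lefschetzDomain ℚ (⟨countingG E, countingG_mem_totalLieAlgebraRat Φ⟩ : totalLieAlgebraRat Φ)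
      (adDegree ℚ (⟨countingG E, countingG_mem_totalLieAlgebraRat Φ⟩ : totalLieAlgebraRat Φ) 2)) :
    HasLefschetzProperty (LieAlgebra.ad ℚ (totalLieAlgebraRat Φ) ⟨countingG E, countingG_mem_totalLieAlgebraRat Φ⟩)
      (LieAlgebra.ad ℚ (totalLieAlgebraRat Φ) e) :=
  (isJordanLefschetzPair_totalLieAlgebraRat' Φ).hasLefschetzProperty_ad he

/-- … in particular `ad e_η` for every rational non-degenerate `2`-form `η`. [cite: LooijengaLunts1997, §1 p. 7 L58–L64, §3 (3.3)] -/
theorem hasLefschetzProperty_ad_lefschetzG_totalLieAlgebraRat {η : E [⋀^Fin 2]→L[ℝ] ℝ}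
    (hη : ofRealForm η ∈ rationalForms Φ 2) (hnd : ∀ v : E, v ≠ 0 → ∃ w : E, η ![v, w] ≠ 0) :
    HasLefschetzProperty (LieAlgebra.ad ℚ (totalLieAlgebraRat Φ) ⟨countingG E, countingG_mem_totalLieAlgebraRat Φ⟩)
      (LieAlgebra.ad ℚ (totalLieAlgebraRat Φ)
        ⟨lefschetzG η, totalLieAlgebraRatDeg_le Φ 2 (lefschetzTriple_mem_totalLieAlgebraRatDeg Φ hη hnd).1.1⟩) :=
  hasLefschetzProperty_ad_totalLieAlgebraRat Φ (mem_lefschetzDomain_totalLieAlgebraRat Φ hη hnd).1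

variable {η₀ : E [⋀^Fin 2]→L[ℝ] ℝ}

/-- **(i) for `(𝔤_NS(X; ℚ), h)` of an abelian variety** (polarisation `η₀`): every `e` in the domain of `f` on `𝔤_NS(X; ℚ)₂`
acts on `(𝔤_NS(X; ℚ), ad h)` with the Lefschetz property. [cite: LooijengaLunts1997, §1 p. 7 L58–L64, §3 (3.6)] -/
theorem IsRiemannForm.hasLefschetzProperty_ad_neronSeveriLieAlgebraRat (hη₀ : IsRiemannForm Φ η₀)
    {e : neronSeveriLieAlgebraRat Φ}
    (he : e ∈ lefschetzDomain ℚ (⟨countingG E, hη₀.countingG_mem_neronSeveriLieAlgebraRat Φ⟩ : neronSeveriLieAlgebraRat Φ)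
      (adDegree ℚ (⟨countingG E, hη₀.countingG_mem_neronSeveriLieAlgebraRat Φ⟩ : neronSeveriLieAlgebraRat Φ) 2)) :
    HasLefschetzProperty
      (LieAlgebra.ad ℚ (neronSeveriLieAlgebraRat Φ) ⟨countingG E, hη₀.countingG_mem_neronSeveriLieAlgebraRat Φ⟩)
      (LieAlgebra.ad ℚ (neronSeveriLieAlgebraRat Φ) e) :=
  (hη₀.isJordanLefschetzPair_neronSeveriLieAlgebraRat Φ).hasLefschetzProperty_ad he

end Adjoint

/-! ### §5 The depth of `(H•(X; ℂ), h)` is `g` -/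

section Depth

variable {E : Type*} [NormedAddCommGroup E] [NormedSpace ℂ E] [FiniteDimensional ℂ E]

/-- No degrees above `g`: `M_n = 0` for `n > g` (forms of degree `> 2g = dim_ℝ V` vanish).
[cite: LooijengaLunts1997, §1 (1.1) p. 4 L58–L60 (depth)] [cite: Huybrechts2005, Def. 1.2.25] -/
theorem degreeSpace_countingG_eq_bot_of_gt {n : ℤ} (hn : (finrank ℂ E : ℤ) < n) : degreeSpace (countingG E) n = ⊥ := by
  rw [Submodule.eq_bot_iff]
  intro w hw
  rw [degreeSpace, mem_eigenspace_countingG_iff] at hw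
  funext m
  by_cases hm : ((m : ℂ) - (finrank ℂ E : ℂ)) = ((n : ℤ) : ℂ)
  · have h' : (((m : ℤ) - (finrank ℂ E : ℤ) : ℤ) : ℂ) = ((n : ℤ) : ℂ) := by push_cast; exact hm
    have h1 := Int.cast_inj.1 h'
    exact eq_zero_of_finrank_real_lt (w m) (by rw [finrank_real_of_complex]; omega)
  · exact hw m hm

variable [Nontrivial E]

omit [FiniteDimensional ℂ E] [Nontrivial E] in
/-- `M_{-g} = ⋀⁰ ≠ 0` (the constant `0`-form `1`). [cite: Huybrechts2005, Def. 1.2.25] -/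
theorem degreeSpace_countingG_neg_ne_bot : degreeSpace (countingG E) (-(finrank ℂ E : ℤ)) ≠ ⊥ := by
  set c : E [⋀^Fin 0]→L[ℝ] ℂ := ContinuousAlternatingMap.constOfIsEmpty ℝ E (Fin 0) 1 with hc_def
  have hc : c ≠ 0 := by
    intro hc
    have h0 := DFunLike.congr_fun hc Fin.elim0
    simp [hc_def] at h0
  have hmem : GForm.of 0 c ∈ degreeSpace (countingG E) (-(finrank ℂ E : ℤ)) := by
    have h1 := of_mem_degreeSpace_countingG (E := E) 0 c
    rwa [Nat.cast_zero, zero_sub] at h1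
  intro hbot
  rw [hbot, Submodule.mem_bot, GForm.of_eq_zero_iff] at hmem
  exact hc hmem

/-- … hence, by the Lefschetz isomorphism `e_η^g : M_{-g} ≅ M_g` of any non-degenerate `η`, **`M_g = ⋀^{2g} ≠ 0`**.
[cite: LooijengaLunts1997, §1 (1.1) p. 4 L58–L60 ("M_n ≠ 0 (or equivalently, M_{-n} ≠ 0)")] -/
theorem degreeSpace_countingG_ne_bot : degreeSpace (countingG E) (finrank ℂ E : ℤ) ≠ ⊥ := by
  obtain ⟨n, ⟨b⟩⟩ := exists_splitBasis_aux (E := E)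
  have L := hasLefschetzProperty_lefschetzG (frameForm_nondegenerate b)
  intro hbot
  apply degreeSpace_countingG_neg_ne_bot (E := E)
  rw [Submodule.eq_bot_iff]
  intro w hw
  refine L.eq_zero_of_pow_apply_eq_zero (n := (finrank ℂ E : ℤ)) (by omega) hw ?_
  have h1 : (lefschetzG (frameForm b) ^ ((finrank ℂ E : ℤ)).toNat) w ∈ degreeSpace (countingG E) (finrank ℂ E : ℤ) :=
    (L.bijOn_int (by omega : (0 : ℤ) ≤ (finrank ℂ E : ℤ))).mapsTo hw
  rw [hbot, Submodule.mem_bot] at h1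
  exact h1

/-- **The depth of `(H•(X; ℂ), h)` is `g = dim_ℂ X`** ("we call greatest integer `n` with `M_n ≠ 0` … the depth of `M`";
row A1-88's `depth`). [cite: LooijengaLunts1997, §1 (1.1) p. 4 L58–L60, §3 (3.3) ("H^{ev}(X)[n] … a fundamental Jordan–Lefschetz module")] -/
theorem depth_countingG : depth (countingG E) = finrank ℂ E := by
  obtain ⟨n, ⟨b⟩⟩ := exists_splitBasis_aux (E := E)
  have L := hasLefschetzProperty_lefschetzG (frameForm_nondegenerate b)
  refine le_antisymm (csSup_le' fun m hm ↦ ?_) (L.le_depth degreeSpace_countingG_ne_bot)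
  by_contra hlt
  exact hm (degreeSpace_countingG_eq_bot_of_gt (by exact_mod_cast not_le.1 hlt))

end Depth

end ComplexTorus

end Literature.Geometry.Kaehler

end
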